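import Literature.AlgebraicGeometry.GroupSchemes.EtaleHopfIdealsOfPoints             -- ★ p847607: `eq_ker_pi_ptEquiv_points`, `finrank_quotient_eq_natCard_points`, `etale_specOver_quotient`
import Literature.AlgebraicGeometry.GroupSchemes.HopfIdealClosedSubgroup              -- ★ §4 `le_ker_ptEquiv_mul` ∕ `_one` ∕ `_inv`
import Literature.AlgebraicGeometry.GroupSchemes.FrobeniusKillsQuotientSupersingular  -- ★ `FrobKillSS.surjective_pi_ptEquiv_of_injective` (CRT over a field)
import Literature.AlgebraicGeometry.GroupSchemes.AffineGroupSchemeBialgHom            -- ★ `ptEquiv_comp` (naturality of `ptEquiv` in the scheme)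
import HarnessLib

/-!
# Admissible subgroups of points = admissible ideals, on a finite étale group scheme over a separably closed field
# ([Tate1997FiniteFlatGroupSchemes] (3.7); [GortzWedhorn2023] (27.2.1); [StacksProject] 00U3)

Topic `Literature/AlgebraicGeometry/GroupSchemes`; namespace `Literature.AlgebraicGeometry.GroupSchemes.EtaleIdealPoints` (continues ★
`EtaleIdealEqPointsIdeal` ∕ ★ `EtaleHopfIdealsOfPoints`).  THEOREMS ONLY (no definition, no instance, no notation, no named fact, no `sorry`).
Cell `hodgecm-mathlib` (D-0151), programme P6 «MOD» (crux hLiu418 = stmt-HodgeConjecture-24832, `--supports`, count-neutral): organ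
**(UP-ADM)** for the D-line socket `stub_SPEC` (`Cruxes/HLiu418/Lines/F0_P6a_DatumOfInputs.lean` ED. 1, L2 deal (O1)): the glue between the
carrier `LineOf I y` — a `Subgroup` of `Ω`-POINTS of the generic layer with `Nat.card = q` and `𝒪_F`-stability — and the IDEAL currency in
which ★ `spI` (D5 `AdmissibleIdealSpecialFibre`), ★ (E-b4′) `CanonicalLineAssembly.existsUnique_admK_spI_eq_kerFI` and ★ SP-SURJ
`AdmSpecialFibreSurj.exists_admissible_spI_eq_of_ordinary` are stated (they quantify over ADMISSIBLE IDEALS `L ⊂ Γ(𝒢_K)`: Hopf, corank `q`,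
stable under the algebra maps of the endomorphisms).  HC_CM is proved only modulo the printed citations until rung 0 closes; this file is
generic and changes no count.

THE PRINT.  [Tate1997FiniteFlatGroupSchemes] (3.7): a finite ÉTALE group scheme `G` over a separably closed field `k` «is» its finite group
of points `G(k)`; closed subgroup schemes `H ↪ G` ↔ subgroups `H(k) ≤ G(k)`, the order of `H` being `|H(k)|`.  [GortzWedhorn2023] (27.2.1):
closed subgroup schemes of the affine `G = Spec A` ↔ Hopf ideals `I ⊂ A`.  [StacksProject] 00U3: `A` étale over `k` separably closed is
`k^n`, every ideal is the ideal `I_S` of functions vanishing on a subset `S` of the points and `dim_k A ⧸ I_S = |S|`.  Hence, for a set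
`β` of endomorphisms of `G`: {subgroups `H ≤ G(k)` of order `r` with `β_a(H) ⊆ H`} ↔ {Hopf ideals `I` of corank `r` with `Γ(β_a)(I) ⊆ I`},
`H ↦ I_H = ⋂_{x ∈ H} ker φ_x`, `I ↦ V(I)(k)`; under it «`x ∈ H`» reads «`I_H ≤ ker φ_x`».

## Contents (points = `specOver k k ⟶ G`, a group under Mathlib's scoped `Hom.group`; `φ_x = ptEquiv G k x : Γ(G) →ₐ[k] k`)
* §1 ANY field `k`, `G` affine `k`-group, `H` a FINITE subgroup of points, `π_H := (φ_x)_{x ∈ H} : Γ(G) → k^H`: `surjective_pi_ptEquiv_subgroup`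
  (CRT), **`isHopfIdeal_ker_pi_subgroup`** (★ `isHopfIdeal_ker_pi`), **`finrank_quotient_ker_pi_subgroup`** (`= Nat.card H`),
  **`ker_pi_subgroup_le_ker_ptEquiv_iff`** (`I_H ≤ ker φ_x ↔ x ∈ H`), `etale_specOver_quotient_ker_pi_subgroup`, and STABILITY
  **`map_appTop_ker_pi_subgroup_le_iff`** (`Γ(φ)(I_H) ⊆ I_H ↔ H ≫ φ ⊆ H` for any `k`-morphism `φ : G ⟶ G`);
* §2 `k` SEPARABLY CLOSED, `G → Spec k` finite étale: **`exists_subgroup_of_isHopfIdeal`** (a Hopf ideal is `I_H` for the subgroup `H = V(I)(k)`,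
  ★ `HopfIdealClosedSubgroup` §4 + ★ `eq_ker_pi_ptEquiv_points`), HEAD **`exists_equiv_admissible`** (the bijection {`Nat.card H = r`, `β`-stable}
  `≃` {Hopf, corank `r`, `Γ(β a)`-stable} reading membership as `I ≤ ker φ_x` — the `IsAdm` triple of `Lines/F0_P6c_DictConstructors` UNFOLDED, as in
  ★ `CanonicalLineAssembly`), **`natCard_admissible_ideals_eq`** (so ★ `LinesInRankTwoTorsionModule`'s `q + 1` lines are `q + 1` admissible
  ideals — the `htwo` input of ★ SP-SURJ), **`existsUnique_admissible_ideal_of_subgroup`**;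
* §3 TRANSPORT ALONG A MONOMORPHIC HOMOMORPHISM `ι : K ⟶ G` (`x ↦ x ≫ ι`, Mathlib `IsMonHom.monoidHom`): **`exists_equiv_subgroup_of_mono`** —
  {`β'`-stable subgroups of `K(k)` of order `r`} `≃` {`β`-stable subgroups of `G(k)` of order `r` inside the image of `ι`} when `β' a ≫ ι = ι ≫ β a`
  (with ★ (S-c) `IdealTorsion.exists_comp_kerι_eq_iff_forall_mem`: «lines of `A_y(Ω)` killed by `𝔭`» = «subgroups of `A_y[𝔭](Ω)`»).

## References
* [Tate1997FiniteFlatGroupSchemes] J. Tate, *Finite flat group schemes*, in: Modular Forms and Fermat's Last Theorem (1997), (3.7).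
* [GortzWedhorn2023] U. Görtz, T. Wedhorn, *Algebraic Geometry II* (2023), §(27.2) (27.2.1), p. 607.
* [StacksProject] The Stacks Project, Tags 00U3, 00DT.
-/

set_option autoImplicit false

-- Mathlib's `Over`/`Scheme` APIs are stated across semireducible wrappers (as in the ★ `GroupSchemes/*` files).
set_option backward.isDefEq.respectTransparency false

universe u

open CategoryTheory CategoryTheory.Limits AlgebraicGeometry MonoidalCategory CartesianMonoidalCategory
open scoped MonObj

noncomputable section

namespace Literature.AlgebraicGeometry.GroupSchemes

namespace EtaleIdealPoints

open Literature.AlgebraicGeometry.Motives AffineGroupScheme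

/-! ## §1 The points ideal `I_H = ker π_H` of a finite subgroup `H` of points (any field) -/

section AnyField

variable {k : Type u} [Field k] (G : SchemeOver k) [GrpObj G] [IsAffine G.left] (H : Subgroup (Motives.specOver k k ⟶ G))

/-- **CRT**: evaluation at the (pairwise distinct) points of a finite subgroup `H ≤ G(k)` is SURJECTIVE `Γ(G) ↠ k^H`
(★ `FrobKillSS.surjective_pi_ptEquiv_of_injective` on the injective family `Subtype.val`). [cite: StacksProject, Tag 00DT] -/
theorem surjective_pi_ptEquiv_subgroup [Finite ↥H] :
    Function.Surjective (AlgHom.pi fun x : ↥H => ptEquiv G k x.1 : Alg G →ₐ[k] (↥H → k)) :=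
  FrobKillSS.surjective_pi_ptEquiv_of_injective G (fun x : ↥H => x.1) Subtype.val_injective

/-- **`I_H` IS A HOPF IDEAL** (★ `isHopfIdeal_ker_pi`: `H` contains `1` and is closed under products and inverses).
[cite: GortzWedhorn2023, §(27.2) (27.2.1) (p. 607)] [cite: Tate1997FiniteFlatGroupSchemes, (3.7)] -/
theorem isHopfIdeal_ker_pi_subgroup [Finite ↥H] :
    (RingHom.ker (AlgHom.pi fun x : ↥H => ptEquiv G k x.1 : Alg G →ₐ[k] (↥H → k)).toRingHom).IsHopfIdeal k :=
  isHopfIdeal_ker_pi G (fun x : ↥H => x.1) (surjective_pi_ptEquiv_subgroup G H) ⟨1, rfl⟩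
    (fun x y => ⟨x * y, rfl⟩) fun x => ⟨x⁻¹, rfl⟩

/-- **CORANK OF `I_H` = ORDER OF `H`**: `Γ(G) ⧸ I_H ≅ k^H` (first isomorphism theorem for the surjection `π_H`), so
`dim_k Γ(G) ⧸ I_H = |H|`. [cite: StacksProject, Tag 00U3] [cite: Tate1997FiniteFlatGroupSchemes, (3.7)] -/
theorem finrank_quotient_ker_pi_subgroup [Finite ↥H] :
    Module.finrank k (Alg G ⧸ RingHom.ker (AlgHom.pi fun x : ↥H => ptEquiv G k x.1 : Alg G →ₐ[k] (↥H → k)).toRingHom) = Nat.card ↥H := by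
  classical
  cases nonempty_fintype ↥H
  have e : (Alg G ⧸ RingHom.ker (AlgHom.pi fun x : ↥H => ptEquiv G k x.1 : Alg G →ₐ[k] (↥H → k)).toRingHom) ≃ₗ[k] (↥H → k) :=
    (Ideal.quotientKerAlgEquivOfSurjective (surjective_pi_ptEquiv_subgroup G H)).toLinearEquiv
  rw [e.finrank_eq, Module.finrank_fintype_fun_eq_card, Nat.card_eq_fintype_card]

/-- **THE POINTS OF `V(I_H)` ARE EXACTLY `H`**: `I_H ≤ ker φ_x ↔ x ∈ H` (a field is local: ★ `exists_eq_of_ker_pi_le_ker_ptEquiv` — a character of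
`k^H` is an evaluation; conversely ★ `ker_pi_le_ker_ptEquiv`). [cite: StacksProject, Tag 00U3] [cite: GortzWedhorn2023, §(27.2) (27.2.1) (p. 607)] -/
theorem ker_pi_subgroup_le_ker_ptEquiv_iff [Finite ↥H] (x : Motives.specOver k k ⟶ G) :
    RingHom.ker (AlgHom.pi fun x : ↥H => ptEquiv G k x.1 : Alg G →ₐ[k] (↥H → k)).toRingHom ≤ RingHom.ker (ptEquiv G k x).toRingHom ↔
      x ∈ H := by
  constructor
  · intro hx
    obtain ⟨i, hi⟩ := exists_eq_of_ker_pi_le_ker_ptEquiv G (fun x : ↥H => x.1) (surjective_pi_ptEquiv_subgroup G H) x hx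
    rw [hi]
    exact i.2
  · intro hx
    exact ker_pi_le_ker_ptEquiv G (fun x : ↥H => x.1) ⟨x, hx⟩

/-- `Spec (Γ(G) ⧸ I_H) → Spec k` is ÉTALE (`Γ(G) ⧸ I_H ≅ k^H`, ★ `etale_specOver_quotient_ker_hom`). [cite: StacksProject, Tag 00U3] -/
theorem etale_specOver_quotient_ker_pi_subgroup [Finite ↥H] :
    Etale (Motives.specOver k (Alg G ⧸ RingHom.ker (AlgHom.pi fun x : ↥H => ptEquiv G k x.1 : Alg G →ₐ[k] (↥H → k)).toRingHom)).hom :=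
  etale_specOver_quotient_ker_hom _ (surjective_pi_ptEquiv_subgroup G H)

omit [GrpObj G] in
/-- The algebra map of `x ≫ φ` is `φ_x ∘ Γ(φ)` on elements (★ `ptEquiv_comp`, ★ `Alg.comap_apply`). [cite: GortzWedhorn2023, §(27.2) (p. 606)] -/
theorem ptEquiv_comp_apply_appTop {G' : SchemeOver k} [IsAffine G'.left] (x : Motives.specOver k k ⟶ G) (φ : G ⟶ G') (a : Alg G') :
    ptEquiv G' k (x ≫ φ) a = ptEquiv G k x (φ.left.appTop.hom a) := by
  rw [ptEquiv_comp, AlgHom.comp_apply, Alg.comap_apply]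

/-- **STABILITY DICTIONARY**: for any `k`-morphism `φ : G ⟶ G` (e.g. the endomorphism `β a` of an `𝒪`-action), `Γ(φ)(I_H) ⊆ I_H` iff `H` is
stable under `x ↦ x ≫ φ` — because `φ_{x ≫ φ} = φ_x ∘ Γ(φ)` and the points of `V(I_H)` are exactly `H`.
[cite: Tate1997FiniteFlatGroupSchemes, (3.7)] [cite: GortzWedhorn2023, §(27.2) (27.2.1) (p. 607)] -/
theorem map_appTop_ker_pi_subgroup_le_iff [Finite ↥H] (φ : G ⟶ G) :
    (RingHom.ker (AlgHom.pi fun x : ↥H => ptEquiv G k x.1 : Alg G →ₐ[k] (↥H → k)).toRingHom).map φ.left.appTop.hom ≤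
        RingHom.ker (AlgHom.pi fun x : ↥H => ptEquiv G k x.1 : Alg G →ₐ[k] (↥H → k)).toRingHom ↔
      ∀ x ∈ H, x ≫ φ ∈ H := by
  constructor
  · intro hle x hx
    rw [← ker_pi_subgroup_le_ker_ptEquiv_iff G H]
    intro a ha
    rw [RingHom.mem_ker, AlgHom.toRingHom_eq_coe, AlgHom.coe_toRingHom, ptEquiv_comp_apply_appTop]
    have hmem := hle (Ideal.mem_map_of_mem φ.left.appTop.hom ha)
    exact (mem_ker_pi_ptEquiv_iff G (fun x : ↥H => x.1) _).1 hmem ⟨x, hx⟩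
  · intro hstab
    rw [Ideal.map_le_iff_le_comap]
    intro a ha
    rw [Ideal.mem_comap]
    refine (mem_ker_pi_ptEquiv_iff G (fun x : ↥H => x.1) _).2 fun x => ?_
    have h := (mem_ker_pi_ptEquiv_iff G (fun x : ↥H => x.1) a).1 ha ⟨x.1 ≫ φ, hstab x.1 x.2⟩
    rwa [ptEquiv_comp_apply_appTop] at h

end AnyField

/-! ## §2 Over a separably closed field, on a finite ÉTALE group: Hopf ideals are points ideals of subgroups; the admissible bijection -/

section Etale

variable {k : Type u} [Field k] [IsSepClosed k] (G : SchemeOver k) [GrpObj G] [IsAffine G.left] [IsFinite G.hom] [Etale G.hom]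

omit [IsSepClosed k] [Etale G.hom] [GrpObj G] in
/-- The `k`-points of a FINITE `k`-scheme are finite (★ `finite_algHom_of_isFinite` transported along ★ `ptEquiv`).
[cite: GortzWedhorn2023, §(27.2) (p. 606)] -/
theorem finite_specOver_hom : Finite (Motives.specOver k k ⟶ G) :=
  haveI := finite_algHom_of_isFinite (k := k) G
  Finite.of_equiv _ (ptEquiv G k).symm

omit [IsFinite G.hom] in
/-- **A HOPF IDEAL OF A FINITE ÉTALE GROUP IS THE POINTS IDEAL OF A SUBGROUP**: the points `V(I)(k) = {x | I ≤ ker φ_x}` form a subgroup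
`H` (★ `le_ker_ptEquiv_mul` ∕ `_one` ∕ `_inv`) and `I = I_H` (★ `eq_ker_pi_ptEquiv_points`).
[cite: Tate1997FiniteFlatGroupSchemes, (3.7)] [cite: GortzWedhorn2023, §(27.2) (27.2.1) (p. 607)] -/
theorem exists_subgroup_of_isHopfIdeal (I : Ideal (Alg G)) (hI : I.IsHopfIdeal k) :
    ∃ H : Subgroup (Motives.specOver k k ⟶ G), (∀ x, x ∈ H ↔ I ≤ RingHom.ker (ptEquiv G k x).toRingHom) ∧
      I = RingHom.ker (AlgHom.pi fun x : ↥H => ptEquiv G k x.1 : Alg G →ₐ[k] (↥H → k)).toRingHom := by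
  haveI := hI
  let H : Subgroup (Motives.specOver k k ⟶ G) :=
    { carrier := {x | I ≤ RingHom.ker (ptEquiv G k x).toRingHom}
      mul_mem' := fun hu hv => le_ker_ptEquiv_mul G I hu hv
      one_mem' := le_ker_ptEquiv_one G I
      inv_mem' := fun hu => le_ker_ptEquiv_inv G I hu }
  have hmem : ∀ x, x ∈ H ↔ I ≤ RingHom.ker (ptEquiv G k x).toRingHom := fun x => Iff.rfl
  refine ⟨H, hmem, ?_⟩
  -- `I = I_{V(I)(k)}` (★ `eq_ker_pi_ptEquiv_points`), and `V(I)(k)` is the carrier of `H`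
  have hIeq := eq_ker_pi_ptEquiv_points G I
  ext a
  constructor
  · intro ha
    exact (mem_ker_pi_ptEquiv_iff G (fun x : ↥H => x.1) a).2 fun x => ((hmem x.1).1 x.2) ha
  · intro ha
    rw [hIeq]
    exact (mem_ker_pi_ptEquiv_iff G (fun x : {x : Motives.specOver k k ⟶ G // I ≤ RingHom.ker (ptEquiv G k x).toRingHom} => x.1) a).2
      fun x => (mem_ker_pi_ptEquiv_iff G (fun x : ↥H => x.1) a).1 ha ⟨x.1, (hmem x.1).2 x.2⟩

/-- **HEAD — THE ADMISSIBLE BIJECTION.**  On a finite ÉTALE group `G` over a separably closed `k`, with any family of endomorphisms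
`β : σ → (G ⟶ G)` (as `k`-morphisms) and any `r`: {subgroups `H ≤ G(k)` with `|H| = r` and `H ≫ β a ⊆ H` for all `a`} `≃` {ideals `I ⊂ Γ(G)`
that are HOPF, of corank `dim_k Γ(G) ⧸ I = r`, with `Γ(β a)(I) ⊆ I` for all `a`} (= the `IsAdm G β r` triple of the DICT constructors, unfolded),
the bijection `e` reading membership as vanishing: `e(H) ≤ ker φ_x ↔ x ∈ H`.  (`e(H) = I_H`, `e⁻¹(I) = V(I)(k)`: §1 + `exists_subgroup_of_isHopfIdeal`.)
[cite: Tate1997FiniteFlatGroupSchemes, (3.7)] [cite: GortzWedhorn2023, §(27.2) (27.2.1) (p. 607)] [cite: StacksProject, Tag 00U3] -/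
theorem exists_equiv_admissible {σ : Type*} (β : σ → (G ⟶ G)) (r : ℕ) :
    ∃ e : {H : Subgroup (Motives.specOver k k ⟶ G) // Nat.card ↥H = r ∧ ∀ a, ∀ x ∈ H, x ≫ β a ∈ H} ≃
        {I : Ideal (Alg G) // I.IsHopfIdeal k ∧ Module.finrank k (Alg G ⧸ I) = r ∧ ∀ a, I.map (β a).left.appTop.hom ≤ I},
      ∀ H x, ((e H).1 ≤ RingHom.ker (ptEquiv G k x).toRingHom ↔ x ∈ H.1) := by
  haveI := finite_specOver_hom (k := k) G
  -- forward: `H ↦ I_H`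
  let f : {H : Subgroup (Motives.specOver k k ⟶ G) // Nat.card ↥H = r ∧ ∀ a, ∀ x ∈ H, x ≫ β a ∈ H} →
      {I : Ideal (Alg G) // I.IsHopfIdeal k ∧ Module.finrank k (Alg G ⧸ I) = r ∧ ∀ a, I.map (β a).left.appTop.hom ≤ I} := fun H =>
    ⟨RingHom.ker (AlgHom.pi fun x : ↥H.1 => ptEquiv G k x.1 : Alg G →ₐ[k] (↥H.1 → k)).toRingHom,
      isHopfIdeal_ker_pi_subgroup G H.1, (finrank_quotient_ker_pi_subgroup G H.1).trans H.2.1,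
      fun a => (map_appTop_ker_pi_subgroup_le_iff G H.1 (β a)).2 (H.2.2 a)⟩
  have hf : ∀ H x, ((f H).1 ≤ RingHom.ker (ptEquiv G k x).toRingHom ↔ x ∈ H.1) := fun H x =>
    ker_pi_subgroup_le_ker_ptEquiv_iff G H.1 x
  -- `f` is injective (points of `V(I_H)` are `H`) and surjective (every Hopf ideal is an `I_H`, order = corank, stability transported)
  have hinj : Function.Injective f := by
    intro H₁ H₂ h
    apply Subtype.ext
    ext x
    rw [← hf H₁ x, ← hf H₂ x, h]
  have hsurj : Function.Surjective f := by
    rintro ⟨I, hIH, hIr, hIβ⟩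
    obtain ⟨H, hHmem, hHI⟩ := exists_subgroup_of_isHopfIdeal G I hIH
    have hcard : Nat.card ↥H = r := by rw [← hIr, hHI, finrank_quotient_ker_pi_subgroup]
    have hstab : ∀ a, ∀ x ∈ H, x ≫ β a ∈ H := fun a => by
      rw [← map_appTop_ker_pi_subgroup_le_iff G H (β a), ← hHI]; exact hIβ a
    exact ⟨⟨H, hcard, hstab⟩, Subtype.ext hHI.symm⟩
  exact ⟨Equiv.ofBijective f ⟨hinj, hsurj⟩, fun H x => hf H x⟩

/-- **COUNTING COROLLARY**: admissible ideals of corank `r` and `β`-stable subgroups of points of order `r` are EQUINUMEROUS (e.g. with ★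
`LinesInPlane.natCard_submodules_of_isTorsionBySet`: a layer with `G(k) ≅ (𝒪⧸𝔭)²` has `N𝔭 + 1` admissible ideals of corank `N𝔭` — the `htwo`
input of ★ SP-SURJ). [cite: Tate1997FiniteFlatGroupSchemes, (3.7)] [cite: StacksProject, Tag 00U3] -/
theorem natCard_admissible_ideals_eq {σ : Type*} (β : σ → (G ⟶ G)) (r : ℕ) :
    Nat.card {I : Ideal (Alg G) // I.IsHopfIdeal k ∧ Module.finrank k (Alg G ⧸ I) = r ∧ ∀ a, I.map (β a).left.appTop.hom ≤ I} =
      Nat.card {H : Subgroup (Motives.specOver k k ⟶ G) // Nat.card ↥H = r ∧ ∀ a, ∀ x ∈ H, x ≫ β a ∈ H} := by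
  obtain ⟨e, -⟩ := exists_equiv_admissible G β r
  exact Nat.card_congr e.symm

/-- **`∃!` FORM**: every `β`-stable subgroup `H ≤ G(k)` of order `r` is the set of points of EXACTLY ONE admissible ideal of corank `r`.
[cite: Tate1997FiniteFlatGroupSchemes, (3.7)] [cite: GortzWedhorn2023, §(27.2) (27.2.1) (p. 607)] -/
theorem existsUnique_admissible_ideal_of_subgroup {σ : Type*} (β : σ → (G ⟶ G)) (H : Subgroup (Motives.specOver k k ⟶ G))
    (hβ : ∀ a, ∀ x ∈ H, x ≫ β a ∈ H) :
    ∃! I : Ideal (Alg G), (I.IsHopfIdeal k ∧ Module.finrank k (Alg G ⧸ I) = Nat.card ↥H ∧ ∀ a, I.map (β a).left.appTop.hom ≤ I) ∧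
      ∀ x, I ≤ RingHom.ker (ptEquiv G k x).toRingHom ↔ x ∈ H := by
  obtain ⟨e, he⟩ := exists_equiv_admissible G β (Nat.card ↥H)
  refine ⟨(e ⟨H, rfl, hβ⟩).1, ⟨(e ⟨H, rfl, hβ⟩).2, fun x => he ⟨H, rfl, hβ⟩ x⟩, ?_⟩
  rintro I ⟨hI, hIx⟩
  -- `I` and `e H` are admissible with the same points, hence images under `e` of the same subgroup
  obtain ⟨H', hH'⟩ := e.surjective ⟨I, hI⟩
  have hHH' : H' = ⟨H, rfl, hβ⟩ := by
    apply Subtype.ext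
    ext x
    rw [← he H' x, hH', hIx x]
  rw [← hHH', hH']

/-- **INVERSE READING**: every admissible ideal of corank `r` is the points ideal of a (unique) `β`-stable subgroup of order `r` with the same
points — the direction the `SpSurj` clause of `stub_SPEC` consumes (an admissible ideal upstairs ↦ a LINE). [cite: Tate1997FiniteFlatGroupSchemes, (3.7)] -/
theorem exists_subgroup_of_admissible {σ : Type*} (β : σ → (G ⟶ G)) {r : ℕ} (I : Ideal (Alg G))
    (hI : I.IsHopfIdeal k ∧ Module.finrank k (Alg G ⧸ I) = r ∧ ∀ a, I.map (β a).left.appTop.hom ≤ I) :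
    ∃ H : Subgroup (Motives.specOver k k ⟶ G), Nat.card ↥H = r ∧ (∀ a, ∀ x ∈ H, x ≫ β a ∈ H) ∧
      (∀ x, x ∈ H ↔ I ≤ RingHom.ker (ptEquiv G k x).toRingHom) ∧
      I = RingHom.ker (AlgHom.pi fun x : ↥H => ptEquiv G k x.1 : Alg G →ₐ[k] (↥H → k)).toRingHom := by
  haveI := finite_specOver_hom (k := k) G
  obtain ⟨H, hHmem, hHI⟩ := exists_subgroup_of_isHopfIdeal G I hI.1
  have hcard : Nat.card ↥H = r := by rw [← hI.2.1, hHI, finrank_quotient_ker_pi_subgroup]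
  have hstab : ∀ a, ∀ x ∈ H, x ≫ β a ∈ H := fun a => by
    rw [← map_appTop_ker_pi_subgroup_le_iff G H (β a), ← hHI]; exact hI.2.2 a
  exact ⟨H, hcard, hstab, hHmem, hHI⟩

end Etale

/-! ## §3 Transport of stable subgroups of points along a monomorphic homomorphism `j : K ⟶ G` -/

section Mono

variable {k : Type u} [Field k] {K G : SchemeOver k} [GrpObj K] [GrpObj G] (j : K ⟶ G) [IsMonHom j] [Mono j]

/-- `x ↦ x ≫ j` on points is an INJECTIVE group homomorphism `K(k) ↪ G(k)` (Mathlib `IsMonHom.monoidHom`; `j` mono). [cite: GortzWedhorn2023, §(27.2) (p. 606)] -/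
theorem injective_monoidHom_of_mono : Function.Injective (IsMonHom.monoidHom j (Motives.specOver k k)) :=
  fun _ _ h => (cancel_mono j).1 h

/-- **TRANSPORT ALONG A MONOMORPHIC HOMOMORPHISM.**  For `ι : K ↪ G` a monomorphism of `k`-group schemes which is a homomorphism, and
endomorphism families `β'` of `K`, `β` of `G` INTERTWINED by `j` (`β' a ≫ j = j ≫ β a`): {`β'`-stable subgroups `H' ≤ K(k)` of order `r`} `≃`
{`β`-stable subgroups `H ≤ G(k)` of order `r` all of whose members factor through `j`}, by `H' ↦ H' ≫ j`; membership: `x ≫ j ∈ e(H') ↔ x ∈ H'`.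
With ★ (S-c) `IdealTorsion.exists_comp_kerι_eq_iff_forall_mem` («factors through `A[𝔭] ↪ A`» ↔ «killed by `𝔭`») this reads the D-line carrier
`LineOf I y` (subgroups of `A_y(Ω)` of order `q`, killed by `𝔭`, `𝒪_F`-stable) as the order-`q` `𝒪_F`-stable subgroups of `A_y[𝔭](Ω)`.
[cite: Tate1997FiniteFlatGroupSchemes, (3.7)] [cite: GortzWedhorn2023, §(27.2) (p. 606)] -/
theorem exists_equiv_subgroup_of_mono {σ : Type*} (β' : σ → (K ⟶ K)) (β : σ → (G ⟶ G)) (hcomm : ∀ a, β' a ≫ j = j ≫ β a) (r : ℕ) :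
    ∃ e : {H' : Subgroup (Motives.specOver k k ⟶ K) // Nat.card ↥H' = r ∧ ∀ a, ∀ x ∈ H', x ≫ β' a ∈ H'} ≃
        {H : Subgroup (Motives.specOver k k ⟶ G) // Nat.card ↥H = r ∧ (∀ a, ∀ x ∈ H, x ≫ β a ∈ H) ∧ ∀ x ∈ H, ∃ s : Motives.specOver k k ⟶ K, s ≫ j = x},
      ∀ H' (x : Motives.specOver k k ⟶ K), (x ≫ j ∈ (e H').1 ↔ x ∈ H'.1) := by
  have hinjι := injective_monoidHom_of_mono (k := k) j
  have hmap : ∀ x : Motives.specOver k k ⟶ K, IsMonHom.monoidHom j (Motives.specOver k k) x = x ≫ j := fun _ => rfl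
  -- membership in the image subgroup
  have hmem : ∀ (H' : Subgroup (Motives.specOver k k ⟶ K)) (x : Motives.specOver k k ⟶ K),
      x ≫ j ∈ H'.map (IsMonHom.monoidHom j (Motives.specOver k k)) ↔ x ∈ H' := fun H' x => by
    rw [← hmap]; exact Subgroup.mem_map_iff_mem hinjι
  let f : {H' : Subgroup (Motives.specOver k k ⟶ K) // Nat.card ↥H' = r ∧ ∀ a, ∀ x ∈ H', x ≫ β' a ∈ H'} →
      {H : Subgroup (Motives.specOver k k ⟶ G) // Nat.card ↥H = r ∧ (∀ a, ∀ x ∈ H, x ≫ β a ∈ H) ∧ ∀ x ∈ H, ∃ s : Motives.specOver k k ⟶ K, s ≫ j = x} :=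
    fun H' => ⟨H'.1.map (IsMonHom.monoidHom j (Motives.specOver k k)), by
      refine ⟨?_, fun a x hx => ?_, fun x hx => ?_⟩
      · exact (Subgroup.card_map_of_injective hinjι).trans H'.2.1
      · obtain ⟨y, hy, rfl⟩ := Subgroup.mem_map.1 hx
        rw [hmap, Category.assoc, ← hcomm a, ← Category.assoc, hmem]
        exact H'.2.2 a y hy
      · obtain ⟨y, -, rfl⟩ := Subgroup.mem_map.1 hx
        exact ⟨y, (hmap y).symm⟩⟩
  have hf : ∀ H' (x : Motives.specOver k k ⟶ K), (x ≫ j ∈ (f H').1 ↔ x ∈ H'.1) := fun H' x => hmem H'.1 x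
  have hinj : Function.Injective f := by
    intro H₁ H₂ h
    apply Subtype.ext
    ext x
    rw [← hf H₁ x, ← hf H₂ x, h]
  have hsurj : Function.Surjective f := by
    rintro ⟨H, hHr, hHβ, hHι⟩
    let H' : Subgroup (Motives.specOver k k ⟶ K) := H.comap (IsMonHom.monoidHom j (Motives.specOver k k))
    have hH'map : H'.map (IsMonHom.monoidHom j (Motives.specOver k k)) = H := by
      rw [Subgroup.map_comap_eq_self]
      intro x hx
      obtain ⟨s, hs⟩ := hHι x hx
      exact ⟨s, hs⟩
    have hcard : Nat.card ↥H' = r := by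
      rw [← hHr, ← hH'map]
      exact (Subgroup.card_map_of_injective hinjι).symm
    have hstab : ∀ a, ∀ x ∈ H', x ≫ β' a ∈ H' := fun a x hx => by
      change (x ≫ β' a) ≫ j ∈ H
      rw [Category.assoc, hcomm a, ← Category.assoc]
      exact hHβ a _ hx
    exact ⟨⟨H', hcard, hstab⟩, Subtype.ext hH'map⟩
  exact ⟨Equiv.ofBijective f ⟨hinj, hsurj⟩, fun H' x => hf H' x⟩

end Mono

end EtaleIdealPoints

end Literature.AlgebraicGeometry.GroupSchemes

end
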